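import Summits.QuantumFields.YangMills.Theorems.UnitScaleTiltProp7GreenPiBlockDecayOfLetters
import HarnessLib

/-!
# Route `UnitScaleTilt`, crux K1 «MinimiserStabilityRegPr» (stmt-QuantumFields-19200), EX rows `h133`∕`norm_Hπ` — NORM_G ROAD brick N6, FILE D3: **THE `hGblk` TEXT FROM BLOCK-SUPPORTED
# LETTERS** (rate bookkeeping: a block-supported letter at rate `δ₁ ≥ δ + ν` is a weighted letter at rate `δ` with the coarse volume `(2(1+1∕ν))³`; then FILE D2's bootstrap)

Cell `ym3-torus` (HUMAN RULING D-0037; rung R3 = SU(2) YM₃ on T³ — NOT d = 4, NOT infinite volume, NOT a mass gap, NOT Clay).  Fleet lead ∕ chair seat `ym-ust-19200-p1` (gen 27),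
CHAIR WORD №30.  THEOREMS ONLY (0 `def`, 0 `sorry`); `--supports stmt-QuantumFields-19200 --as helper`; count-neutral.

WHAT IS PROVED (ns `…Theorems.Prop7GreenPiBlockLettersEdition`; member `F n K`, `h : n ≤ K`, weights `c₀ cB > 0`, coupling `0 ≤ a`, rates `0 ≤ δ`, `0 < ν`, `δ + ν ≤ δ₁`).
* ★★ `weighted_of_blockSupported` — ABSTRACT: for any block-additive reader `Φ : (ι → M₂(ℂ)) → κ → M₂(ℂ)` (`Φ(Σ_z f_z) = Σ_z Φ(f_z)`), a block-supported letter «input supported in block `z`,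
  sup `≤ s` ⟹ `‖Φ X k‖ ≤ s·C·e^{−δ₁dc(loc k, z)}`» implies the weighted letter «`‖Y i‖ ≤ m·e^{−δ·dc(blk i, z)}` ⟹ `‖Φ Y k‖ ≤ C(2(1+1∕ν))³·m·e^{−δ·dc(loc k, z)}`»
  (block pieces, triangle inequality, ✓`sum_exp_neg_mul_tdist_coarse_le`).
* ★★★ `hGblk_pi_of_blockLetters` — on `RegPr α`, `PosOnto` at `Δ^η` and `Δ_πᴾ`: FIVE BLOCK-SUPPORTED letters at rate `δ₁` — (Gb) block VALUE row of `G₀` (px16 ✓`Prop7OneFormGreenSupBound` §3's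
  text), (Db) block DIVERGENCE row of `G₀` ((dκ)), (c1b)(c2b)(c3b) block editions of the scalar storey's `G′ᴾR_S`, `DG′ᴾR_S`, `R_SG′ᴾ` — and FILE D2's window with the constants
  `×(2(1+1∕ν))³` give the H-DOOR's `hGblk` text at the Π-slot VERBATIM (✓`Prop7Kernel133DoorOfKinvRow.kernel133_of_kinvRow_of_greenBlockSup`, binders `X z hXz s hs hX bd`) with
  `C_G := 2(BV + BD)(2(1+1∕ν))³` at rate `δ`, plus the divergence twin.
HONEST SCOPE.  Bookkeeping over displayed letters; their suppliers are named, not proved here; nothing of `h133`, `norm_G`, the 8 EX rows, `hThm2S`, EX or the crux is proved; nothing continuum ∕ Clay.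

References: T. Bałaban, CMP **99** (1985) 389–434 [Balaban1985BackgroundPropagators] ((3.42) p.397, (3.47)–(3.49) pp.398–399, Thm 3.12 p.423).
-/

set_option autoImplicit false

noncomputable section

open scoped Matrix.Norms.L2Operator BigOperators InnerProductSpace ComplexConjugate
open Complex (I)

namespace Summit.QuantumFields.YangMills.Theorems.Prop7GreenPiBlockLettersEdition

open Literature.MathematicalPhysics.QuantumFieldTheory.Balaban1983to89
open Literature.MathematicalPhysics.QuantumFieldTheory.Balaban1983to89.T3ContinuumYM3Torus
open T3PrintedRegularMinimiser (RegPr)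
open T3SectALandauChart (formComp bgUnits eta eta_pos)
open B5Eq118OneStroke (iterBlockOf)
open B9TorusCalculus (torusT)
open B9Eq39Adjoint (R bondPair J)
open B9Eq310Hermitian (norm_R_le)
open B9Eq3131Pointwise (norm_I_ad_le)
open Beta.BackgroundVertices (ad ad_apply)
open B9Eq311L2Pairing (WL2)
open B11Eq103H1Complex (SiteL2K BondL2K)
open Summit.QuantumFields.YangMills.Theorems.Prop7SectET3Transport (periodsT3)
open Summit.QuantumFields.YangMills.Theorems.Prop7SectET3HilbertLetters (W₂ toL2 toL2S QL2 DL2 DstarL2 covLapSite adjoint_DL2)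
open Summit.QuantumFields.YangMills.Theorems.Prop7SectET3GaugeProjector (NS RS RS_RS)
open Summit.QuantumFields.YangMills.Theorems.Prop7SectET3WilsonHessian (DeltaEta DeltaEtaSlot DeltaEta_isSymmetric)
open Summit.QuantumFields.YangMills.Theorems.Prop7SectET3CurvedPropagators (Qk laplaceA PosOnto GT)
open Summit.QuantumFields.YangMills.Theorems.Prop7SectET3DeltaPiPInv (GprimeP gaugeCorrP DeltaPiSlotP gaugeCorrP_apply)
open Summit.QuantumFields.YangMills.Theorems.Prop7SecondOrderDict (norm_bgUnits_le_one)
open Summit.QuantumFields.YangMills.Theorems.Prop7DeltaPiDefectPairing (inner_DL2_toL2S_DeltaEta_toL2 norm_J_one_le_of_regPr)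
open Summit.QuantumFields.YangMills.Theorems.Prop7CurrentPairingPointwise (norm_apply_le_of_norm_inner_siteSingle_le norm_symm_DeltaEta_DL2_toL2S_apply_le)
open Summit.QuantumFields.YangMills.Theorems.Prop7GreenPiSupRowsOfLetters (GT_pi_eq_four_terms covLapSite_lambda₂ bootstrap_two pointwise_of_four_terms)
open Summit.QuantumFields.YangMills.Theorems.Prop7BlockDistanceWeights (tdist_iterBlockOf_le tdist_src_tgt_le_one tdist_coarse_triangle tdist_coarse_comm sum_exp_neg_mul_tdist_coarse_le)

open Summit.QuantumFields.YangMills.Theorems.Prop7GreenPiBlockDecayOfLetters (hGblk_pi_of_letters)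
variable {F : T3Family} {n K : ℕ} {h : n ≤ K} {c₀ cB a : ℝ}

/-! ## §3 Block-supported letters ⟹ weighted letters (rate bookkeeping), and the `hGblk` text from BLOCK letters -/

section BlockToWeighted

/-- ★★ **BLOCK-SUPPORTED LETTER ⟹ WEIGHTED LETTER** (abstract; any block-additive `Φ`): if every input supported in block `z` with sup `≤ s` is mapped to outputs
`≤ s·C·e^{−δ₁·dc(loc k, z)}`, then every input with `‖Y i‖ ≤ m·e^{−δ·dc(blk i, z)}` is mapped to outputs `≤ C·(2(1+1∕ν))³·m·e^{−δ·dc(loc k, z)}` whenever `δ + ν ≤ δ₁`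
(split `Y` into its block pieces; triangle inequality; coarse volume ✓`sum_exp_neg_mul_tdist_coarse_le`). [cite: Balaban1985BackgroundPropagators, (3.47)–(3.49) pp.398–399] -/
theorem weighted_of_blockSupported {ι κ : Type*} (blk : ι → Site (F.P K) (K - n)) (loc : κ → Site (F.P K) (K - n))
    (Φ : (ι → Matrix (Fin 2) (Fin 2) ℂ) → κ → Matrix (Fin 2) (Fin 2) ℂ)
    (hΦ : ∀ f : Site (F.P K) (K - n) → ι → Matrix (Fin 2) (Fin 2) ℂ, Φ (∑ z, f z) = ∑ z, Φ (f z))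
    {C δ₁ δ ν : ℝ} (hC : 0 ≤ C) (hδ : 0 ≤ δ) (hν : 0 < ν) (hδ₁ : δ + ν ≤ δ₁)
    (hblk : ∀ (X : ι → Matrix (Fin 2) (Fin 2) ℂ) (z : Site (F.P K) (K - n)), (∀ i, X i ≠ 0 → blk i = z) → ∀ s : ℝ, 0 ≤ s → (∀ i, ‖X i‖ ≤ s) →
      ∀ k, ‖Φ X k‖ ≤ s * C * Real.exp (-(δ₁ * (Site.tdist (loc k) z : ℝ))))
    (z : Site (F.P K) (K - n)) (Y : ι → Matrix (Fin 2) (Fin 2) ℂ) (m : ℝ) (hm : 0 ≤ m)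
    (hY : ∀ i, ‖Y i‖ ≤ m * Real.exp (-(δ * (Site.tdist (blk i) z : ℝ)))) (k : κ) :
    ‖Φ Y k‖ ≤ C * (2 * (1 + 1 / ν)) ^ 3 * m * Real.exp (-(δ * (Site.tdist (loc k) z : ℝ))) := by
  classical
  -- block pieces
  let Yz : Site (F.P K) (K - n) → ι → Matrix (Fin 2) (Fin 2) ℂ := fun z' i => if blk i = z' then Y i else 0
  have hsum : ∑ z', Yz z' = Y := by
    funext i
    rw [Finset.sum_apply]
    exact (Finset.sum_ite_eq _ _ _).trans (if_pos (Finset.mem_univ _))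
  have hsplit : Φ Y k = ∑ z', Φ (Yz z') k := by rw [← hsum, hΦ, Finset.sum_apply]
  have hsupp : ∀ z' i, Yz z' i ≠ 0 → blk i = z' := fun z' i hi => by by_contra hne; exact hi (if_neg hne)
  have hsup : ∀ z' i, ‖Yz z' i‖ ≤ m * Real.exp (-(δ * (Site.tdist z' z : ℝ))) := fun z' i => by
    by_cases hi : blk i = z'
    · change ‖if blk i = z' then Y i else 0‖ ≤ _
      rw [if_pos hi, ← hi]; exact hY i
    · change ‖if blk i = z' then Y i else 0‖ ≤ _
      rw [if_neg hi, norm_zero]; positivity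
  -- each piece, with the rate bookkeeping
  have hpiece : ∀ z', ‖Φ (Yz z') k‖ ≤ C * m * Real.exp (-(δ * (Site.tdist (loc k) z : ℝ))) * Real.exp (-(ν * (Site.tdist z' (loc k) : ℝ))) := by
    intro z'
    have h1 := hblk (Yz z') z' (hsupp z') _ (by positivity) (hsup z') k
    have ht := tdist_coarse_triangle F (loc k) z' z
    have hb : (0 : ℝ) ≤ (Site.tdist (loc k) z' : ℝ) := Nat.cast_nonneg _
    have hexp : Real.exp (-(δ * (Site.tdist z' z : ℝ))) * Real.exp (-(δ₁ * (Site.tdist (loc k) z' : ℝ)))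
        ≤ Real.exp (-(δ * (Site.tdist (loc k) z : ℝ))) * Real.exp (-(ν * (Site.tdist z' (loc k) : ℝ))) := by
      rw [← Real.exp_add, ← Real.exp_add, Real.exp_le_exp, tdist_coarse_comm F z' (loc k)]
      nlinarith [mul_le_mul_of_nonneg_left ht hδ, mul_le_mul_of_nonneg_right hδ₁ hb]
    calc ‖Φ (Yz z') k‖ ≤ m * Real.exp (-(δ * (Site.tdist z' z : ℝ))) * C * Real.exp (-(δ₁ * (Site.tdist (loc k) z' : ℝ))) := h1
      _ = C * m * (Real.exp (-(δ * (Site.tdist z' z : ℝ))) * Real.exp (-(δ₁ * (Site.tdist (loc k) z' : ℝ)))) := by ring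
      _ ≤ C * m * (Real.exp (-(δ * (Site.tdist (loc k) z : ℝ))) * Real.exp (-(ν * (Site.tdist z' (loc k) : ℝ)))) := mul_le_mul_of_nonneg_left hexp (by positivity)
      _ = _ := by ring
  have hvol := sum_exp_neg_mul_tdist_coarse_le (F := F) (n := n) hν (loc k)
  calc ‖Φ Y k‖ = ‖∑ z', Φ (Yz z') k‖ := by rw [hsplit]
    _ ≤ ∑ z', C * m * Real.exp (-(δ * (Site.tdist (loc k) z : ℝ))) * Real.exp (-(ν * (Site.tdist z' (loc k) : ℝ))) := (norm_sum_le _ _).trans (Finset.sum_le_sum fun z' _ => hpiece z')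
    _ = C * m * Real.exp (-(δ * (Site.tdist (loc k) z : ℝ))) * ∑ z', Real.exp (-(ν * (Site.tdist z' (loc k) : ℝ))) := by rw [Finset.mul_sum]
    _ ≤ C * m * Real.exp (-(δ * (Site.tdist (loc k) z : ℝ))) * (2 * (1 + 1 / ν)) ^ 3 := mul_le_mul_of_nonneg_left hvol (by positivity)
    _ = _ := by ring

variable [Fact (0 < c₀)] [Fact (0 < cB)]

/-- ★★★ **THE `hGblk` TEXT (Π-slot) + DIVERGENCE TWIN FROM FIVE BLOCK-SUPPORTED LETTERS** — the directly dockable edition: (Gb) = px16's N4 §3 block VALUE row of `G₀`, (Db) = the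
block DIVERGENCE row of `G₀` ((dκ)), (c1b)(c2b)(c3b) = block editions of the scalar-storey (c)-package, all at rate `δ₁ ≥ δ + ν`; constants pick up the coarse volume `V := (2(1+1∕ν))³`
(`weighted_of_blockSupported`) and the window is FILE D's with `BV·V, BD·V, C₁·V, C₂·V, C₃·V`.  Output: `C_G := 2(BV·V + BD·V)` at rate `δ`, binders `X z hXz s hs hX bd`.
[cite: Balaban1985BackgroundPropagators, Thm 3.12 p.423, (3.42) p.397, (3.47)–(3.49) pp.398–399] -/
theorem hGblk_pi_of_blockLetters {α δ δ₁ ν : ℝ} (hδ : 0 ≤ δ) (hν : 0 < ν) (hδ₁ : δ + ν ≤ δ₁)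
    (U₀ : GaugeField (F.P K) 0 (Matrix.specialUnitaryGroup (Fin 2) ℂ)) (hreg : RegPr F n K α U₀) (ha : 0 ≤ a)
    (hp₀ : PosOnto F n K h c₀ cB a (DeltaEtaSlot F n K c₀) U₀) (hpπ : PosOnto F n K h c₀ cB a (DeltaPiSlotP F n K h c₀ cB a) U₀)
    {BV BD C₁ C₂ C₃ : ℝ} (hBV : 0 ≤ BV) (hBD : 0 ≤ BD) (hC₁ : 0 ≤ C₁) (hC₂ : 0 ≤ C₂) (hC₃ : 0 ≤ C₃)
    (hGb : ∀ (X : PBond (F.P K) 0 → Matrix (Fin 2) (Fin 2) ℂ) (z : Site (F.P K) (K - n)), (∀ b, X b ≠ 0 → iterBlockOf (K - n) b.src = z) →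
      ∀ s : ℝ, 0 ≤ s → (∀ b, ‖X b‖ ≤ s) →
        ∀ bd : PBond (F.P K) 0, ‖(toL2 F K c₀).symm (GT F n K h c₀ cB a (DeltaEtaSlot F n K c₀) U₀ (toL2 F K c₀ X)) bd‖
          ≤ s * BV * Real.exp (-(δ₁ * (Site.tdist (P := F.P K) (iterBlockOf (K - n) bd.src) z : ℝ))))
    (hDb : ∀ (X : PBond (F.P K) 0 → Matrix (Fin 2) (Fin 2) ℂ) (z : Site (F.P K) (K - n)), (∀ b, X b ≠ 0 → iterBlockOf (K - n) b.src = z) →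
      ∀ s : ℝ, 0 ≤ s → (∀ b, ‖X b‖ ≤ s) →
        ∀ x : Site (F.P K) 0, ‖(toL2S F K c₀).symm (DstarL2 F n K c₀ U₀ (GT F n K h c₀ cB a (DeltaEtaSlot F n K c₀) U₀ (toL2 F K c₀ X))) x‖
          ≤ s * BD * Real.exp (-(δ₁ * (Site.tdist (P := F.P K) (iterBlockOf (K - n) x) z : ℝ))))
    (hc1b : ∀ (v : Site (F.P K) 0 → Matrix (Fin 2) (Fin 2) ℂ) (z : Site (F.P K) (K - n)), (∀ y, v y ≠ 0 → iterBlockOf (K - n) y = z) →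
      ∀ m : ℝ, 0 ≤ m → (∀ y, ‖v y‖ ≤ m) →
        ∀ y : Site (F.P K) 0, ‖(toL2S F K c₀).symm (GprimeP F n K h c₀ cB a U₀ (RS F n K h c₀ cB U₀ (toL2S F K c₀ v))) y‖
          ≤ m * C₁ * Real.exp (-(δ₁ * (Site.tdist (P := F.P K) (iterBlockOf (K - n) y) z : ℝ))))
    (hc2b : ∀ (v : Site (F.P K) 0 → Matrix (Fin 2) (Fin 2) ℂ) (z : Site (F.P K) (K - n)), (∀ y, v y ≠ 0 → iterBlockOf (K - n) y = z) →
      ∀ m : ℝ, 0 ≤ m → (∀ y, ‖v y‖ ≤ m) →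
        ∀ b : PBond (F.P K) 0, ‖(toL2 F K c₀).symm (DL2 F n K c₀ U₀ (GprimeP F n K h c₀ cB a U₀ (RS F n K h c₀ cB U₀ (toL2S F K c₀ v)))) b‖
          ≤ m * C₂ * Real.exp (-(δ₁ * (Site.tdist (P := F.P K) (iterBlockOf (K - n) b.src) z : ℝ))))
    (hc3b : ∀ (v : Site (F.P K) 0 → Matrix (Fin 2) (Fin 2) ℂ) (z : Site (F.P K) (K - n)), (∀ y, v y ≠ 0 → iterBlockOf (K - n) y = z) →
      ∀ m : ℝ, 0 ≤ m → (∀ y, ‖v y‖ ≤ m) →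
        ∀ y : Site (F.P K) 0, ‖(toL2S F K c₀).symm (RS F n K h c₀ cB U₀ (GprimeP F n K h c₀ cB a U₀ (toL2S F K c₀ v))) y‖
          ≤ m * C₃ * Real.exp (-(δ₁ * (Site.tdist (P := F.P K) (iterBlockOf (K - n) y) z : ℝ))))
    (hwin : 2 * (1 + Real.exp (4 * δ)) * (α * (C₁ * (2 * (1 + 1 / ν)) ^ 3) * (BV * (2 * (1 + 1 / ν)) ^ 3 + BD * (2 * (1 + 1 / ν)) ^ 3)
      + 3 * α * (C₃ * (2 * (1 + 1 / ν)) ^ 3) * (1 + C₂ * (2 * (1 + 1 / ν)) ^ 3)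
        * (1 + C₂ * (2 * (1 + 1 / ν)) ^ 3 + 2 * (1 + Real.exp (4 * δ)) * α * (C₁ * (2 * (1 + 1 / ν)) ^ 3) * (BV * (2 * (1 + 1 / ν)) ^ 3 + BD * (2 * (1 + 1 / ν)) ^ 3))) ≤ 1 / 2) :
    (∀ (X : PBond (F.P K) 0 → Matrix (Fin 2) (Fin 2) ℂ) (z : Site (F.P K) (K - n)), (∀ b, X b ≠ 0 → iterBlockOf (K - n) b.src = z) →
      ∀ s : ℝ, 0 ≤ s → (∀ b, ‖X b‖ ≤ s) →
        ∀ bd : PBond (F.P K) 0, ‖(toL2 F K c₀).symm (GT F n K h c₀ cB a (DeltaPiSlotP F n K h c₀ cB a) U₀ (toL2 F K c₀ X)) bd‖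
          ≤ s * (2 * (BV * (2 * (1 + 1 / ν)) ^ 3 + BD * (2 * (1 + 1 / ν)) ^ 3)) * Real.exp (-(δ * (Site.tdist (P := F.P K) (iterBlockOf (K - n) bd.src) z : ℝ)))) ∧
    (∀ (X : PBond (F.P K) 0 → Matrix (Fin 2) (Fin 2) ℂ) (z : Site (F.P K) (K - n)), (∀ b, X b ≠ 0 → iterBlockOf (K - n) b.src = z) →
      ∀ s : ℝ, 0 ≤ s → (∀ b, ‖X b‖ ≤ s) →
        ∀ x : Site (F.P K) 0, ‖(toL2S F K c₀).symm (DstarL2 F n K c₀ U₀ (GT F n K h c₀ cB a (DeltaPiSlotP F n K h c₀ cB a) U₀ (toL2 F K c₀ X))) x‖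
          ≤ s * (2 * (BV * (2 * (1 + 1 / ν)) ^ 3 + BD * (2 * (1 + 1 / ν)) ^ 3)) * Real.exp (-(δ * (Site.tdist (P := F.P K) (iterBlockOf (K - n) x) z : ℝ)))) := by
  have hV : 0 ≤ (2 * (1 + 1 / ν)) ^ 3 := by positivity
  -- block-additivity of the five readers
  have hΦG : ∀ f : Site (F.P K) (K - n) → PBond (F.P K) 0 → Matrix (Fin 2) (Fin 2) ℂ,
      (fun X bd => (toL2 F K c₀).symm (GT F n K h c₀ cB a (DeltaEtaSlot F n K c₀) U₀ (toL2 F K c₀ X)) bd) (∑ z, f z)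
        = ∑ z, (fun X bd => (toL2 F K c₀).symm (GT F n K h c₀ cB a (DeltaEtaSlot F n K c₀) U₀ (toL2 F K c₀ X)) bd) (f z) := fun f => by
    funext bd; simp only [map_sum, Finset.sum_apply]
  have hΦD : ∀ f : Site (F.P K) (K - n) → PBond (F.P K) 0 → Matrix (Fin 2) (Fin 2) ℂ,
      (fun X x => (toL2S F K c₀).symm (DstarL2 F n K c₀ U₀ (GT F n K h c₀ cB a (DeltaEtaSlot F n K c₀) U₀ (toL2 F K c₀ X))) x) (∑ z, f z)
        = ∑ z, (fun X x => (toL2S F K c₀).symm (DstarL2 F n K c₀ U₀ (GT F n K h c₀ cB a (DeltaEtaSlot F n K c₀) U₀ (toL2 F K c₀ X))) x) (f z) := fun f => by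
    funext x; simp only [map_sum, Finset.sum_apply]
  have hΦ1 : ∀ f : Site (F.P K) (K - n) → Site (F.P K) 0 → Matrix (Fin 2) (Fin 2) ℂ,
      (fun v y => (toL2S F K c₀).symm (GprimeP F n K h c₀ cB a U₀ (RS F n K h c₀ cB U₀ (toL2S F K c₀ v))) y) (∑ z, f z)
        = ∑ z, (fun v y => (toL2S F K c₀).symm (GprimeP F n K h c₀ cB a U₀ (RS F n K h c₀ cB U₀ (toL2S F K c₀ v))) y) (f z) := fun f => by
    funext y; simp only [map_sum, Finset.sum_apply]
  have hΦ2 : ∀ f : Site (F.P K) (K - n) → Site (F.P K) 0 → Matrix (Fin 2) (Fin 2) ℂ,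
      (fun v b => (toL2 F K c₀).symm (DL2 F n K c₀ U₀ (GprimeP F n K h c₀ cB a U₀ (RS F n K h c₀ cB U₀ (toL2S F K c₀ v)))) b) (∑ z, f z)
        = ∑ z, (fun v b => (toL2 F K c₀).symm (DL2 F n K c₀ U₀ (GprimeP F n K h c₀ cB a U₀ (RS F n K h c₀ cB U₀ (toL2S F K c₀ v)))) b) (f z) := fun f => by
    funext b; simp only [map_sum, Finset.sum_apply]
  have hΦ3 : ∀ f : Site (F.P K) (K - n) → Site (F.P K) 0 → Matrix (Fin 2) (Fin 2) ℂ,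
      (fun v y => (toL2S F K c₀).symm (RS F n K h c₀ cB U₀ (GprimeP F n K h c₀ cB a U₀ (toL2S F K c₀ v))) y) (∑ z, f z)
        = ∑ z, (fun v y => (toL2S F K c₀).symm (RS F n K h c₀ cB U₀ (GprimeP F n K h c₀ cB a U₀ (toL2S F K c₀ v))) y) (f z) := fun f => by
    funext y; simp only [map_sum, Finset.sum_apply]
  -- the five weighted letters at rate `δ`
  have hGw := fun (z : Site (F.P K) (K - n)) (Y : PBond (F.P K) 0 → Matrix (Fin 2) (Fin 2) ℂ) (m : ℝ) (hm : 0 ≤ m)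
      (hY : ∀ b, ‖Y b‖ ≤ m * Real.exp (-(δ * (Site.tdist (iterBlockOf (K - n) b.src) z : ℝ)))) (bd : PBond (F.P K) 0) =>
    weighted_of_blockSupported (fun b : PBond (F.P K) 0 => iterBlockOf (K - n) b.src) (fun bd : PBond (F.P K) 0 => iterBlockOf (K - n) bd.src) _ hΦG hBV hδ hν hδ₁ hGb z Y m hm hY bd
  have hDw := fun (z : Site (F.P K) (K - n)) (Y : PBond (F.P K) 0 → Matrix (Fin 2) (Fin 2) ℂ) (m : ℝ) (hm : 0 ≤ m)
      (hY : ∀ b, ‖Y b‖ ≤ m * Real.exp (-(δ * (Site.tdist (iterBlockOf (K - n) b.src) z : ℝ)))) (x : Site (F.P K) 0) =>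
    weighted_of_blockSupported (fun b : PBond (F.P K) 0 => iterBlockOf (K - n) b.src) (fun x : Site (F.P K) 0 => iterBlockOf (K - n) x) _ hΦD hBD hδ hν hδ₁ hDb z Y m hm hY x
  have hc1w := fun (z : Site (F.P K) (K - n)) (v : Site (F.P K) 0 → Matrix (Fin 2) (Fin 2) ℂ) (m : ℝ) (hm : 0 ≤ m)
      (hv : ∀ y, ‖v y‖ ≤ m * Real.exp (-(δ * (Site.tdist (iterBlockOf (K - n) y) z : ℝ)))) (y : Site (F.P K) 0) =>
    weighted_of_blockSupported (fun y : Site (F.P K) 0 => iterBlockOf (K - n) y) (fun y : Site (F.P K) 0 => iterBlockOf (K - n) y) _ hΦ1 hC₁ hδ hν hδ₁ hc1b z v m hm hv y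
  have hc2w := fun (z : Site (F.P K) (K - n)) (v : Site (F.P K) 0 → Matrix (Fin 2) (Fin 2) ℂ) (m : ℝ) (hm : 0 ≤ m)
      (hv : ∀ y, ‖v y‖ ≤ m * Real.exp (-(δ * (Site.tdist (iterBlockOf (K - n) y) z : ℝ)))) (b : PBond (F.P K) 0) =>
    weighted_of_blockSupported (fun y : Site (F.P K) 0 => iterBlockOf (K - n) y) (fun b : PBond (F.P K) 0 => iterBlockOf (K - n) b.src) _ hΦ2 hC₂ hδ hν hδ₁ hc2b z v m hm hv b
  have hc3w := fun (z : Site (F.P K) (K - n)) (v : Site (F.P K) 0 → Matrix (Fin 2) (Fin 2) ℂ) (m : ℝ) (hm : 0 ≤ m)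
      (hv : ∀ y, ‖v y‖ ≤ m * Real.exp (-(δ * (Site.tdist (iterBlockOf (K - n) y) z : ℝ)))) (y : Site (F.P K) 0) =>
    weighted_of_blockSupported (fun y : Site (F.P K) 0 => iterBlockOf (K - n) y) (fun y : Site (F.P K) 0 => iterBlockOf (K - n) y) _ hΦ3 hC₃ hδ hν hδ₁ hc3b z v m hm hv y
  have key := hGblk_pi_of_letters (BV := BV * (2 * (1 + 1 / ν)) ^ 3) (BD := BD * (2 * (1 + 1 / ν)) ^ 3) (C₁ := C₁ * (2 * (1 + 1 / ν)) ^ 3)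
    (C₂ := C₂ * (2 * (1 + 1 / ν)) ^ 3) (C₃ := C₃ * (2 * (1 + 1 / ν)) ^ 3) hδ U₀ hreg ha hp₀ hpπ
    (mul_nonneg hBV hV) (mul_nonneg hBD hV) (mul_nonneg hC₁ hV) (mul_nonneg hC₂ hV) (mul_nonneg hC₃ hV)
    (fun z Y m hm hY bd => (hGw z Y m hm hY bd).trans (le_of_eq (by ring)))
    (fun z Y m hm hY x => (hDw z Y m hm hY x).trans (le_of_eq (by ring)))
    (fun z v m hm hv y => (hc1w z v m hm hv y).trans (le_of_eq (by ring)))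
    (fun z v m hm hv b => (hc2w z v m hm hv b).trans (le_of_eq (by ring)))
    (fun z v m hm hv y => (hc3w z v m hm hv y).trans (le_of_eq (by ring)))
    hwin
  exact key

end BlockToWeighted

end Summit.QuantumFields.YangMills.Theorems.Prop7GreenPiBlockLettersEdition

end
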